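import Mathlib
import HarnessLib
import Summits.Ventures.LatticeQCDFlow.Scoring.IMHAcceptanceRecordJumpKernel
import Summits.Ventures.LatticeQCDFlow.Scoring.DoeblinGreenKubo

/-!
# The IMH acceptance record VIII: the jump chain and the full chain share their Poisson solutions

HONEST FRAMING: exact (Metropolis-corrected) sampling algorithms for lattice gauge theory; figures
of merit are autocorrelation/cost numbers at stated couplings and volumes; no continuum-physics
claim.  This file is value-free (no number of ours appears) and nothing in it is cited as a fact.

NEW WORK (tree-internal): VII (`IMHAcceptanceRecordJumpKernel`) made the chain of ACCEPTED
configurations of the flow-MCMC kernel `K = indepMH q w` a Markov kernel `J̃ = imhJump q w`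
(`kop J̃ g = (J g)/α`, `α = imhAcceptMass`), reversible and Doeblin with constant `ā = ∫ α dπ` under
its tilt `π̃ = imhTilt q w π`.  Here the two chains are put on ONE footing for `τ_int`:
* **Operator splitting** (`kop_indepMH_eq_jump`): `K = α J̃ + (1 − α) I` on bounded observables,
  so `h − K h = α (h − J̃ h)` (`sub_kop_indepMH_eq_jump`): a bounded `h` solves the Poisson
  equation of `K` for `ḡ` iff it solves that of `J̃` for `ḡ/α`.
* **An acceptance floor `α ≥ m > 0` is a weight ceiling `w ≤ 1/m`**, hence Doeblin for the full
  chain, `K(x, ·) ≥ m π` (`indepMH_doeblin_of_acceptFloor`; `Exactness.indepMH_apply_ge`).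
* **Shared Poisson solution** (`exists_shared_poisson`, floor `m`; bounded measurable π-centred
  `ḡ`): the Neumann series of `J̃` (`poisson_exists_of_doeblin` at VII's rate `1 − ā/2`) solves
  BOTH equations, so Green–Kubo holds for both chains with ONE `h`
  (`hasSum_autocov_of_shared_poisson`): `Σ_{t ≥ 0} C^K_ḡ(t) = ∫ ḡ h dπ = ā Σ_{t ≥ 0} C^J̃_{ḡ/α}(t)`.
* **THE `τ_int` TRANSFER LAW** on the tree's `Scoring.tauInt` (`tauInt_indepMH_eq_jump`):
  `(τ_int(K, ḡ) + 1/2) · ∫ ḡ² dπ = (τ_int(J̃, ḡ/α) + 1/2) · ∫ ḡ²/α dπ`; equivalently the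
  asymptotic-variance identity `σ²_K(ḡ) = ā σ²_J̃(ḡ/α) + (∫ ḡ²/α dπ − ∫ ḡ² dπ)`
  (`asympVar_indepMH_eq_jump`, `σ² := 2 τ_int C(0)`; the bracket is `≥ 0` by
  `JumpVar.integral_sq_le_div`, whence the ranking `ā σ²_J̃(ḡ/α) ≤ σ²_K(ḡ)`).
* **THE TWO-SIDED HARMONIC-ACCEPTANCE LAW** (`harmonicMean_le_tauInt_indepMH`,
  `tauInt_indepMH_le_harmonicMean`): with `⟨1/α⟩_ḡ := ∫ ḡ²/α dπ / ∫ ḡ² dπ`,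
  `⟨1/α⟩_ḡ − 1/2 ≤ τ_int(K, ḡ) ≤ ⟨1/α⟩_ḡ / ā − 1/2` — lower from positivity of `J̃` at every lag
  (VII `autocov_imhJump_nonneg`), upper from VII's `τ_int(J̃) ≤ 1/ā − 1/2`.  Lattice instance:
  `flowSampler_tauInt_jump_law` (every volume; floor `m = e^{−2δ}` from the Lüscher defect `δ`).

Printed counterparts, NAMED ONLY (not used, not cited as facts): the variance identity
`var(f, P) = π(f²/ρ) − π(f²) + π(ρ) var(f/ρ, P̃)` for a reversible `P` and its jump chain `P̃`, and
the isometry `T : f ↦ f/ρ` between the `(I − P)⁻¹`- and `(I − P̃)⁻¹`-inner products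
[corpus:paper:arxiv-1606.08373 p.5, Thm. 1 and the Remark after it; there attributed in part to
Doucet–Pitt–Deligiannidis–Kohn 2015, Prop. 2]; jump-chain/MH variance relations
[corpus:paper:arxiv-1609.02541 p.12 Rem. 10; p.30 Prop. 28]; Douc–Robert 2011 (Rao–Blackwellised
sojourns) [galaxy:pdf:-7173847574603489160 p.2].  NOT CLAIMED here: a path-level CLT or any
statement about estimators built from the accepted states; the identity without an acceptance
floor (print needs only `ḡ/α ∈ L²(π̃)`; here `ḡ/α` must be bounded); the Cauchy–Schwarz
comparison `⟨1/α⟩_ḡ ≥ 1/⟨α⟩_ḡ` with `IndepMHRejectionFloor` (not spelled out); optimality of either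
bound; continuum statements.
-/

noncomputable section
namespace Summit.Ventures.LatticeQCDFlow.Scoring

open MeasureTheory ProbabilityTheory Filter Finset Summit.Ventures.LatticeQCDFlow.Exactness
open scoped ENNReal Topology

variable {Ω : Type*} [MeasurableSpace Ω]
variable {q : Measure Ω} [IsProbabilityMeasure q] {w : Ω → ℝ} {π : Measure Ω}

/-! ### §0 An acceptance floor: real form, weight ceiling, Doeblin for the full chain -/

/-- Real form of an acceptance floor: `m ≤ α(x)`. -/
theorem JumpVar.le_toReal_acceptMass {m : ℝ} (hm : ∀ x, ENNReal.ofReal m ≤ imhAcceptMass q w x)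
    (x : Ω) : m ≤ (imhAcceptMass q w x).toReal := by
  rcases le_or_gt m 0 with h | h
  · exact h.trans ENNReal.toReal_nonneg
  · have h' := ENNReal.toReal_mono (imhAcceptMass_ne_top x) (hm x)
    rwa [ENNReal.toReal_ofReal h.le] at h'

/-- `(∫ α dπ).toReal = ā` is positive (`π = w q` a probability law). -/
theorem JumpVar.toReal_abar_pos (hw : Measurable w) (hw0 : ∀ x, 0 < w x)
    [IsProbabilityMeasure π] : 0 < (∫⁻ x, imhAcceptMass q w x ∂π).toReal :=
  ENNReal.toReal_pos (lintegral_imhAcceptMass_ne_zero hw hw0)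
    (ne_top_of_le_ne_top ENNReal.one_ne_top (lintegral_imhAcceptMass_le_one π))

omit [IsProbabilityMeasure q] in
/-- **An acceptance floor is a weight ceiling**: `m ≤ α` and `w q = π` a probability law give
`w ≤ 1/m`. -/
theorem JumpVar.weight_le_of_acceptFloor (hw0 : ∀ x, 0 < w x) [IsProbabilityMeasure π]
    (hπ : (q.withDensity fun x => ENNReal.ofReal (w x)) = π) {m : ℝ} (hm0 : 0 < m)
    (hm : ∀ x, ENNReal.ofReal m ≤ imhAcceptMass q w x) (x : Ω) : w x ≤ 1 / m := by
  have hq1 : ∫⁻ y, ENNReal.ofReal (w y) ∂q = 1 := by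
    rw [← setLIntegral_univ, ← withDensity_apply _ MeasurableSet.univ, hπ, measure_univ]
  have h := (hm x).trans (imhAcceptMass_le (q := q) hw0 x)
  rw [hq1, mul_one, ENNReal.ofReal_le_ofReal_iff (inv_nonneg.2 (hw0 x).le)] at h
  rw [le_div_iff₀ hm0]
  calc w x * m ≤ w x * (w x)⁻¹ := mul_le_mul_of_nonneg_left h (hw0 x).le
    _ = 1 := mul_inv_cancel₀ (hw0 x).ne'

/-- **… hence DOEBLIN FOR THE FULL CHAIN**: `m · π(B) ≤ K(x, B)` (`indepMH_apply_ge`, `M = 1/m`). -/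
theorem indepMH_doeblin_of_acceptFloor (hw : Measurable w) (hw0 : ∀ x, 0 < w x)
    [IsProbabilityMeasure π] (hπ : (q.withDensity fun x => ENNReal.ofReal (w x)) = π) {m : ℝ}
    (hm0 : 0 < m) (hm : ∀ x, ENNReal.ofReal m ≤ imhAcceptMass q w x) (x : Ω) {B : Set Ω}
    (hB : MeasurableSet B) : ENNReal.ofReal m * π B ≤ indepMH q w x B := by
  have hM := JumpVar.weight_le_of_acceptFloor (q := q) (π := π) hw0 hπ hm0 hm
  have h := indepMH_apply_ge (q := q) hw hw0 hM x hB
  rwa [hπ, one_div, ENNReal.ofReal_inv_of_pos hm0, inv_inv] at h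

/-! ### §1 Operator splitting: `K = α J̃ + (1 − α) I` -/

/-- **`K = α J̃ + (1 − α) I` ON BOUNDED OBSERVABLES**:
`(K g)(x) = α(x) (J̃ g)(x) + (1 − α(x)) g(x)`. -/
theorem kop_indepMH_eq_jump (hw : Measurable w) (hw0 : ∀ x, 0 < w x) {g : Ω → ℝ}
    (hg : Measurable g) {C : ℝ} (hC : ∀ x, |g x| ≤ C) (x : Ω) :
    kop (indepMH q w) g x
      = (imhAcceptMass q w x).toReal * kop (imhJump q w) g x
        + (1 - (imhAcceptMass q w x).toReal) * g x := by
  rw [kop_imhJump hw hw0 g x, mul_div_assoc',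
    mul_div_cancel_left₀ _ (toReal_imhAcceptMass_pos hw hw0 x).ne',
    integral_imhAccept_mul_eq hw hw0 hg hC x]
  ring

/-- **The two Poisson equations differ by the factor `α`**: `h − K h = α · (h − J̃ h)`. -/
theorem sub_kop_indepMH_eq_jump (hw : Measurable w) (hw0 : ∀ x, 0 < w x) {h : Ω → ℝ}
    (hh : Measurable h) {C : ℝ} (hC : ∀ x, |h x| ≤ C) (x : Ω) :
    h x - kop (indepMH q w) h x
      = (imhAcceptMass q w x).toReal * (h x - kop (imhJump q w) h x) := by
  rw [kop_indepMH_eq_jump hw hw0 hh hC x]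
  ring

/-! ### §2 The observable `ḡ/α` and the shared Poisson solution -/

/-- `ḡ/α` is measurable. -/
theorem JumpVar.measurable_div (hw : Measurable w) {g : Ω → ℝ} (hg : Measurable g) :
    Measurable fun x => g x / (imhAcceptMass q w x).toReal :=
  hg.div (measurable_toReal_imhAcceptMass hw)

/-- `ḡ/α` is bounded by `C/m` under the floor. -/
theorem JumpVar.abs_div_le (hw : Measurable w) (hw0 : ∀ x, 0 < w x) {m : ℝ} (hm0 : 0 < m)
    (hm : ∀ x, ENNReal.ofReal m ≤ imhAcceptMass q w x) {g : Ω → ℝ} {C : ℝ} (hC : ∀ x, |g x| ≤ C)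
    (x : Ω) : |g x / (imhAcceptMass q w x).toReal| ≤ C / m := by
  have hα := toReal_imhAcceptMass_pos (q := q) hw hw0 x
  rw [abs_div, abs_of_pos hα]
  exact (div_le_div_of_nonneg_right (hC x) hα.le).trans
    (div_le_div_of_nonneg_left ((abs_nonneg _).trans (hC x)) hm0
      (JumpVar.le_toReal_acceptMass hm x))

/-- **Tilt means of `F/α` are plain means**: `∫ F/α dπ̃ = (∫ F dπ) / ā` (`integral_imhTilt`). -/
theorem JumpVar.integral_tilt_div (hw : Measurable w) (hw0 : ∀ x, 0 < w x) (π : Measure Ω)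
    (F : Ω → ℝ) :
    ∫ x, F x / (imhAcceptMass q w x).toReal ∂(imhTilt q w π)
      = ((∫⁻ x, imhAcceptMass q w x ∂π).toReal)⁻¹ * ∫ x, F x ∂π := by
  rw [integral_imhTilt hw]
  congr 1
  refine integral_congr_ae (ae_of_all _ fun x => ?_)
  beta_reduce
  rw [mul_div_assoc', mul_div_cancel_left₀ _ (toReal_imhAcceptMass_pos hw hw0 x).ne']

/-- **SHARED POISSON SOLUTION** (`π = w q` a probability law, floor `α ≥ m > 0`; `ḡ` bounded
measurable π-centred): ONE bounded measurable `h` with `h − J̃ h = ḡ/α` AND `h − K h = ḡ`. -/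
theorem exists_shared_poisson (hw : Measurable w) (hw0 : ∀ x, 0 < w x) [IsProbabilityMeasure π]
    (hπ : (q.withDensity fun x => ENNReal.ofReal (w x)) = π) {m : ℝ} (hm0 : 0 < m)
    (hm : ∀ x, ENNReal.ofReal m ≤ imhAcceptMass q w x) {g : Ω → ℝ} (hg : Measurable g) {C : ℝ}
    (hC : ∀ x, |g x| ≤ C) (hg0 : ∫ x, g x ∂π = 0) :
    ∃ h : Ω → ℝ, Measurable h ∧
      (∀ x, |h x| ≤ 2 * (C / m) / (∫⁻ x, imhAcceptMass q w x ∂π).toReal) ∧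
      (∀ x, h x - kop (imhJump q w) h x = g x / (imhAcceptMass q w x).toReal) ∧
      ∀ x, h x - kop (indepMH q w) h x = g x := by
  haveI := isMarkovKernel_imhJump (q := q) hw hw0
  haveI := isProbabilityMeasure_imhTilt (q := q) (π := π) hw hw0
  have hgJ0 : ∫ x, g x / (imhAcceptMass q w x).toReal ∂(imhTilt q w π) = 0 := by
    rw [JumpVar.integral_tilt_div hw hw0, hg0, mul_zero]
  obtain ⟨h, hh, hCh, hpois⟩ := poisson_exists_of_doeblin (imhJump_invariant hw hw0 hπ)
    (fun x B hB => imhJump_doeblin hw hw0 hπ x hB)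
    (pos_iff_ne_zero.2 (lintegral_imhAcceptMass_ne_zero hw hw0)) (JumpVar.measurable_div hw hg)
    (JumpVar.abs_div_le hw hw0 hm0 hm hC) hgJ0
  refine ⟨h, hh, hCh, hpois, fun x => ?_⟩
  rw [sub_kop_indepMH_eq_jump hw hw0 hh hCh x, hpois x, mul_div_assoc',
    mul_div_cancel_left₀ _ (toReal_imhAcceptMass_pos hw hw0 x).ne']

/-- **GREEN–KUBO FOR BOTH CHAINS FROM ONE POISSON SOLUTION**: if `h − J̃ h = ḡ/α` (bounded
measurable `h`), then `Σ_{t ≥ 0} C^K_ḡ(t) = ∫ ḡ h dπ` and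
`Σ_{t ≥ 0} C^J̃_{ḡ/α}(t) = (∫ ḡ h dπ)/ā`. -/
theorem hasSum_autocov_of_shared_poisson (hw : Measurable w) (hw0 : ∀ x, 0 < w x)
    [IsProbabilityMeasure π] (hπ : (q.withDensity fun x => ENNReal.ofReal (w x)) = π) {m : ℝ}
    (hm0 : 0 < m) (hm : ∀ x, ENNReal.ofReal m ≤ imhAcceptMass q w x) {g : Ω → ℝ}
    (hg : Measurable g) {C : ℝ} (hC : ∀ x, |g x| ≤ C) (hg0 : ∫ x, g x ∂π = 0) {h : Ω → ℝ}
    (hh : Measurable h) {Ch : ℝ} (hCh : ∀ x, |h x| ≤ Ch)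
    (hpois : ∀ x, h x - kop (imhJump q w) h x = g x / (imhAcceptMass q w x).toReal) :
    HasSum (fun t => autocov (indepMH q w) π g t) (∫ x, g x * h x ∂π) ∧
      HasSum (fun t => autocov (imhJump q w) (imhTilt q w π)
          (fun x => g x / (imhAcceptMass q w x).toReal) t)
        (((∫⁻ x, imhAcceptMass q w x ∂π).toReal)⁻¹ * ∫ x, g x * h x ∂π) := by
  haveI := isMarkovKernel_imhJump (q := q) hw hw0
  haveI := isProbabilityMeasure_imhTilt (q := q) (π := π) hw hw0
  haveI : Fact (Measurable w) := ⟨hw⟩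
  have hinvK : Kernel.Invariant (indepMH q w) π := by
    rw [← hπ]; exact indepMH_invariant hw hw0
  have hgJ0 : ∫ x, g x / (imhAcceptMass q w x).toReal ∂(imhTilt q w π) = 0 := by
    rw [JumpVar.integral_tilt_div hw hw0, hg0, mul_zero]
  have hpoisK : ∀ x, h x - kop (indepMH q w) h x = g x := fun x => by
    rw [sub_kop_indepMH_eq_jump hw hw0 hh hCh x, hpois x, mul_div_assoc',
      mul_div_cancel_left₀ _ (toReal_imhAcceptMass_pos hw hw0 x).ne']
  refine ⟨greenKubo_hasSum_of_poisson hinvK (indepMH_doeblin_of_acceptFloor hw hw0 hπ hm0 hm)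
    (ENNReal.ofReal_pos.2 hm0) hg hC hg0 hh hCh hpoisK, ?_⟩
  have hJ := greenKubo_hasSum_of_poisson (imhJump_invariant hw hw0 hπ)
    (fun x B hB => imhJump_doeblin hw hw0 hπ x hB)
    (pos_iff_ne_zero.2 (lintegral_imhAcceptMass_ne_zero hw hw0)) (JumpVar.measurable_div hw hg)
    (JumpVar.abs_div_le hw hw0 hm0 hm hC) hgJ0 hh hCh hpois
  have heq : ∫ x, g x / (imhAcceptMass q w x).toReal * h x ∂(imhTilt q w π)
      = ((∫⁻ x, imhAcceptMass q w x ∂π).toReal)⁻¹ * ∫ x, g x * h x ∂π := by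
    rw [← JumpVar.integral_tilt_div hw hw0 π (fun x => g x * h x)]
    exact integral_congr_ae (ae_of_all _ fun x => by ring)
  rwa [heq] at hJ

/-! ### §3 The `τ_int` transfer law and the two-sided harmonic-acceptance law -/

/-- `∫ (ḡ/α)² dπ̃ = (∫ ḡ²/α dπ) / ā`. -/
theorem JumpVar.integral_tilt_div_sq (hw : Measurable w) (hw0 : ∀ x, 0 < w x) (π : Measure Ω)
    (g : Ω → ℝ) :
    ∫ x, (g x / (imhAcceptMass q w x).toReal) ^ 2 ∂(imhTilt q w π)
      = ((∫⁻ x, imhAcceptMass q w x ∂π).toReal)⁻¹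
          * ∫ x, g x ^ 2 / (imhAcceptMass q w x).toReal ∂π := by
  rw [← JumpVar.integral_tilt_div hw hw0 π (fun x => g x ^ 2 / (imhAcceptMass q w x).toReal)]
  exact integral_congr_ae (ae_of_all _ fun x => by ring)

/-- `0 ≤ ∫ ḡ² dπ ≤ ∫ ḡ²/α dπ` (`α ≤ 1`; floor `m` for integrability). -/
theorem JumpVar.integral_sq_le_div (hw : Measurable w) (hw0 : ∀ x, 0 < w x) [IsFiniteMeasure π]
    {m : ℝ} (hm0 : 0 < m) (hm : ∀ x, ENNReal.ofReal m ≤ imhAcceptMass q w x) {g : Ω → ℝ}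
    (hg : Measurable g) {C : ℝ} (hC : ∀ x, |g x| ≤ C) :
    0 ≤ ∫ x, g x ^ 2 ∂π ∧
      ∫ x, g x ^ 2 ∂π ≤ ∫ x, g x ^ 2 / (imhAcceptMass q w x).toReal ∂π := by
  have hsq : ∀ x, |g x ^ 2| ≤ C ^ 2 := fun x => by
    rw [abs_pow]; exact pow_le_pow_left₀ (abs_nonneg _) (hC x) 2
  refine ⟨integral_nonneg fun x => sq_nonneg _, integral_mono
    (integrable_of_bounded π (hg.pow_const 2) hsq)
    (integrable_of_bounded π ((hg.pow_const 2).div (measurable_toReal_imhAcceptMass hw))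
      (C := C ^ 2 / m) fun x => ?_) fun x => ?_⟩
  · have hα := toReal_imhAcceptMass_pos (q := q) hw hw0 x
    rw [abs_div, abs_of_pos hα]
    exact (div_le_div_of_nonneg_right (hsq x) hα.le).trans
      (div_le_div_of_nonneg_left ((abs_nonneg _).trans (hsq x)) hm0
        (JumpVar.le_toReal_acceptMass hm x))
  · exact le_div_self (sq_nonneg _) (toReal_imhAcceptMass_pos hw hw0 x)
      (toReal_imhAcceptMass_le_one x)

/-- **THE `τ_int` TRANSFER LAW** (`π = w q` a probability law, floor `α ≥ m > 0`; `ḡ` bounded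
measurable π-centred, `∫ ḡ² dπ ≠ 0`), on the tree's `Scoring.tauInt`: `(τ_int(K, ḡ) + 1/2) · ∫ ḡ² dπ
= (τ_int(J̃, ḡ/α) + 1/2) · ∫ ḡ²/α dπ` — both sides are `∫ ḡ h dπ` for the shared solution `h`. -/
theorem tauInt_indepMH_eq_jump (hw : Measurable w) (hw0 : ∀ x, 0 < w x)
    [IsProbabilityMeasure π] (hπ : (q.withDensity fun x => ENNReal.ofReal (w x)) = π) {m : ℝ}
    (hm0 : 0 < m) (hm : ∀ x, ENNReal.ofReal m ≤ imhAcceptMass q w x) {g : Ω → ℝ}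
    (hg : Measurable g) {C : ℝ} (hC : ∀ x, |g x| ≤ C) (hg0 : ∫ x, g x ∂π = 0)
    (hV : ∫ x, g x ^ 2 ∂π ≠ 0) :
    (tauInt (fun t => autocov (indepMH q w) π g t / autocov (indepMH q w) π g 0) + 1 / 2)
        * ∫ x, g x ^ 2 ∂π
      = (tauInt (fun t => autocov (imhJump q w) (imhTilt q w π)
            (fun x => g x / (imhAcceptMass q w x).toReal) t
          / autocov (imhJump q w) (imhTilt q w π)
            (fun x => g x / (imhAcceptMass q w x).toReal) 0) + 1 / 2)
        * ∫ x, g x ^ 2 / (imhAcceptMass q w x).toReal ∂π := by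
  haveI := isMarkovKernel_imhJump (q := q) hw hw0
  haveI := isProbabilityMeasure_imhTilt (q := q) (π := π) hw hw0
  haveI : Fact (Measurable w) := ⟨hw⟩
  have hinvK : Kernel.Invariant (indepMH q w) π := by
    rw [← hπ]; exact indepMH_invariant hw hw0
  have hā := JumpVar.toReal_abar_pos (q := q) (π := π) hw hw0
  obtain ⟨hV0, hVle⟩ := JumpVar.integral_sq_le_div (π := π) hw hw0 hm0 hm hg hC
  have hVJ : ∫ x, g x ^ 2 / (imhAcceptMass q w x).toReal ∂π ≠ 0 :=
    ((hV0.lt_of_ne hV.symm).trans_le hVle).ne'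
  have hgJ0 : ∫ x, g x / (imhAcceptMass q w x).toReal ∂(imhTilt q w π) = 0 := by
    rw [JumpVar.integral_tilt_div hw hw0, hg0, mul_zero]
  obtain ⟨h, hh, hCh, hpois, hpoisK⟩ := exists_shared_poisson hw hw0 hπ hm0 hm hg hC hg0
  have hinner : ∫ x, g x / (imhAcceptMass q w x).toReal * h x ∂(imhTilt q w π)
      = ((∫⁻ x, imhAcceptMass q w x ∂π).toReal)⁻¹ * ∫ x, g x * h x ∂π := by
    rw [← JumpVar.integral_tilt_div hw hw0 π (fun x => g x * h x)]
    exact integral_congr_ae (ae_of_all _ fun x => by ring)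
  rw [tauInt_eq_of_poisson hinvK (indepMH_doeblin_of_acceptFloor hw hw0 hπ hm0 hm)
      (ENNReal.ofReal_pos.2 hm0) hg hC hg0 hh hCh hpoisK hV,
    tauInt_eq_of_poisson (imhJump_invariant hw hw0 hπ)
      (fun x B hB => imhJump_doeblin hw hw0 hπ x hB)
      (pos_iff_ne_zero.2 (lintegral_imhAcceptMass_ne_zero hw hw0)) (JumpVar.measurable_div hw hg)
      (JumpVar.abs_div_le hw hw0 hm0 hm hC) hgJ0 hh hCh hpois
      (by rw [JumpVar.integral_tilt_div_sq hw hw0]; exact mul_ne_zero (inv_ne_zero hā.ne') hVJ),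
    hinner, JumpVar.integral_tilt_div_sq hw hw0, sub_add_cancel, sub_add_cancel,
    mul_div_mul_left _ _ (inv_ne_zero hā.ne'), div_mul_cancel₀ _ hV, div_mul_cancel₀ _ hVJ]

/-- **LOWER HARMONIC-ACCEPTANCE LAW**: `∫ ḡ²/α dπ ≤ (τ_int(K, ḡ) + 1/2) · ∫ ḡ² dπ`, i.e.
`τ_int(K, ḡ) ≥ ⟨1/α⟩_ḡ − 1/2` — from `τ_int(J̃, ḡ/α) ≥ 1/2` (VII `autocov_imhJump_nonneg`). -/
theorem harmonicMean_le_tauInt_indepMH (hw : Measurable w) (hw0 : ∀ x, 0 < w x)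
    [IsProbabilityMeasure π] (hπ : (q.withDensity fun x => ENNReal.ofReal (w x)) = π) {m : ℝ}
    (hm0 : 0 < m) (hm : ∀ x, ENNReal.ofReal m ≤ imhAcceptMass q w x) {g : Ω → ℝ}
    (hg : Measurable g) {C : ℝ} (hC : ∀ x, |g x| ≤ C) (hg0 : ∫ x, g x ∂π = 0)
    (hV : ∫ x, g x ^ 2 ∂π ≠ 0) :
    ∫ x, g x ^ 2 / (imhAcceptMass q w x).toReal ∂π
      ≤ (tauInt (fun t => autocov (indepMH q w) π g t / autocov (indepMH q w) π g 0) + 1 / 2)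
          * ∫ x, g x ^ 2 ∂π := by
  obtain ⟨hV0, hVle⟩ := JumpVar.integral_sq_le_div (π := π) hw hw0 hm0 hm hg hC
  rw [tauInt_indepMH_eq_jump hw hw0 hπ hm0 hm hg hC hg0 hV]
  refine le_mul_of_one_le_left (hV0.trans hVle) ?_
  have hnn := fun t => autocov_imhJump_nonneg hw hw0 hπ (JumpVar.measurable_div hw hg)
    (JumpVar.abs_div_le hw hw0 hm0 hm hC) t
  have h0 := fun (ρ : ℕ → ℝ) (h : ∀ t, 0 ≤ ρ t) => (tsum_nonneg h : 0 ≤ ∑' t, ρ t)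
  unfold tauInt
  linarith [h0 _ fun t => div_nonneg (hnn (t + 1)) (hnn 0)]

/-- **UPPER HARMONIC-ACCEPTANCE LAW**: `(τ_int(K, ḡ) + 1/2) · ∫ ḡ² dπ ≤ (∫ ḡ²/α dπ) / ā`, i.e.
`τ_int(K, ḡ) ≤ ⟨1/α⟩_ḡ / ā − 1/2` — from VII's `τ_int(J̃, ḡ/α) ≤ 1/ā − 1/2`. -/
theorem tauInt_indepMH_le_harmonicMean (hw : Measurable w) (hw0 : ∀ x, 0 < w x)
    [IsProbabilityMeasure π] (hπ : (q.withDensity fun x => ENNReal.ofReal (w x)) = π) {m : ℝ}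
    (hm0 : 0 < m) (hm : ∀ x, ENNReal.ofReal m ≤ imhAcceptMass q w x) {g : Ω → ℝ}
    (hg : Measurable g) {C : ℝ} (hC : ∀ x, |g x| ≤ C) (hg0 : ∫ x, g x ∂π = 0)
    (hV : ∫ x, g x ^ 2 ∂π ≠ 0) :
    (tauInt (fun t => autocov (indepMH q w) π g t / autocov (indepMH q w) π g 0) + 1 / 2)
        * ∫ x, g x ^ 2 ∂π
      ≤ (∫ x, g x ^ 2 / (imhAcceptMass q w x).toReal ∂π)
          / (∫⁻ x, imhAcceptMass q w x ∂π).toReal := by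
  obtain ⟨hV0, hVle⟩ := JumpVar.integral_sq_le_div (π := π) hw hw0 hm0 hm hg hC
  rw [tauInt_indepMH_eq_jump hw hw0 hπ hm0 hm hg hC hg0 hV]
  refine (mul_le_mul_of_nonneg_right ?_ (hV0.trans hVle)).trans_eq (inv_mul_eq_div _ _)
  have hτ := tauInt_imhJump_le hw hw0 hπ (JumpVar.measurable_div hw hg)
    (JumpVar.abs_div_le hw hw0 hm0 hm hC)
    ((integral_congr_ae (ae_of_all _ fun x => by
      rw [mul_div_assoc', mul_div_cancel_left₀ _ (toReal_imhAcceptMass_pos hw hw0 x).ne'])).trans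
      hg0)
  rw [one_div] at hτ
  linarith

/-- **THE ASYMPTOTIC-VARIANCE IDENTITY** (`σ² := 2 τ_int · C(0)`):
`σ²_K(ḡ) = ā · σ²_J̃(ḡ/α) + (∫ ḡ²/α dπ − ∫ ḡ² dπ)` (the bracket is `∫ ḡ² (1 − α)/α dπ ≥ 0`). -/
theorem asympVar_indepMH_eq_jump (hw : Measurable w) (hw0 : ∀ x, 0 < w x)
    [IsProbabilityMeasure π] (hπ : (q.withDensity fun x => ENNReal.ofReal (w x)) = π) {m : ℝ}
    (hm0 : 0 < m) (hm : ∀ x, ENNReal.ofReal m ≤ imhAcceptMass q w x) {g : Ω → ℝ}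
    (hg : Measurable g) {C : ℝ} (hC : ∀ x, |g x| ≤ C) (hg0 : ∫ x, g x ∂π = 0)
    (hV : ∫ x, g x ^ 2 ∂π ≠ 0) :
    2 * tauInt (fun t => autocov (indepMH q w) π g t / autocov (indepMH q w) π g 0)
        * autocov (indepMH q w) π g 0
      = (∫⁻ x, imhAcceptMass q w x ∂π).toReal
          * (2 * tauInt (fun t => autocov (imhJump q w) (imhTilt q w π)
                (fun x => g x / (imhAcceptMass q w x).toReal) t
              / autocov (imhJump q w) (imhTilt q w π)
                (fun x => g x / (imhAcceptMass q w x).toReal) 0)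
            * autocov (imhJump q w) (imhTilt q w π)
                (fun x => g x / (imhAcceptMass q w x).toReal) 0)
        + (∫ x, g x ^ 2 / (imhAcceptMass q w x).toReal ∂π - ∫ x, g x ^ 2 ∂π) := by
  have hid := tauInt_indepMH_eq_jump hw hw0 hπ hm0 hm hg hC hg0 hV
  have hā := (JumpVar.toReal_abar_pos (q := q) (π := π) hw hw0).ne'
  rw [autocov_zero, autocov_zero, JumpVar.integral_tilt_div_sq hw hw0] at hid ⊢
  rw [mul_left_comm ((∫⁻ x, imhAcceptMass q w x ∂π).toReal), mul_inv_cancel_left₀ hā]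
  linear_combination 2 * hid

/-! ### §4 The lattice instance -/

section Lattice
open Literature.MathematicalPhysics.QuantumFieldTheory
open Literature.MathematicalPhysics.QuantumFieldTheory.Luscher2010
open Summit.Ventures.LatticeQCDFlow.TrivializingMaps
open scoped Matrix Matrix.Norms.Frobenius ContDiff
variable {d L n : ℕ} [NeZero L]

/-- **THE `τ_int` TRANSFER LAW AND THE TWO-SIDED HARMONIC-ACCEPTANCE LAW FOR AN EXACT FLOW SAMPLER
ON `SU(n)^E` — every volume** (hypotheses of `flowSampler_exact_doeblin`; `q = (Φ 1)_* D[V]`,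
`π` = Boltzmann, floor `α ≥ e^{−2δ}`, `ā ≥ e^{−2δ}`): for every bounded measurable π-centred `ḡ`
with `∫ ḡ² dπ ≠ 0`, `(τ_int(K, ḡ) + 1/2) ∫ ḡ² dπ = (τ_int(J̃, ḡ/α) + 1/2) ∫ ḡ²/α dπ` and
`∫ ḡ²/α dπ ≤ (τ_int(K, ḡ) + 1/2) ∫ ḡ² dπ ≤ (∫ ḡ²/α dπ)/ā`. -/
theorem flowSampler_tauInt_jump_law (B : SuBasis n)
    {S : AmbConfig d L n → ℝ} (hS : ContDiff ℝ ∞ S) {F : ℝ → AmbConfig d L n → ℝ}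
    (hF : ContDiff ℝ ∞ fun p : ℝ × AmbConfig d L n => F p.1 p.2)
    {Φ} (hΦ : IsFlowMap (fun t W => -linkGrad B (F t) W) Φ) {c : ℝ → ℝ} {δ : ℝ}
    (hδ : ∀ t ∈ Set.Icc (0 : ℝ) 1, ∀ U : GaugeConfig d L (Matrix.specialUnitaryGroup (Fin n) ℂ),
      |luscherL B S t (F t) (WilsonFlow.coeConfig U) - S (WilsonFlow.coeConfig U) - c t| ≤ δ)
    (q : Measure (GaugeConfig d L (Matrix.specialUnitaryGroup (Fin n) ℂ))) [IsProbabilityMeasure q]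
    (hq : q = Measure.map (Φ 1) (trivialMeasure (Matrix.specialUnitaryGroup (Fin n) ℂ) d L))
    {π : Measure (GaugeConfig d L (Matrix.specialUnitaryGroup (Fin n) ℂ))} [IsProbabilityMeasure π]
    (hπB : π = boltzmannMeasure fun U => S (WilsonFlow.coeConfig U)) :
    ∃ w : GaugeConfig d L (Matrix.specialUnitaryGroup (Fin n) ℂ) → ℝ, Measurable w ∧
      (q.withDensity fun U => ENNReal.ofReal (w U)) = π ∧
      (∀ U, ENNReal.ofReal (Real.exp (-(2 * δ))) ≤ imhAcceptMass q w U) ∧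
      ENNReal.ofReal (Real.exp (-(2 * δ))) ≤ ∫⁻ U, imhAcceptMass q w U ∂π ∧
      ∀ (g : GaugeConfig d L (Matrix.specialUnitaryGroup (Fin n) ℂ) → ℝ), Measurable g →
        ∀ {C : ℝ}, (∀ U, |g U| ≤ C) → ∫ U, g U ∂π = 0 → ∫ U, g U ^ 2 ∂π ≠ 0 →
        (tauInt (fun t => autocov (indepMH q w) π g t / autocov (indepMH q w) π g 0) + 1 / 2)
              * ∫ U, g U ^ 2 ∂π
            = (tauInt (fun t => autocov (imhJump q w) (imhTilt q w π)
                  (fun U => g U / (imhAcceptMass q w U).toReal) t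
                / autocov (imhJump q w) (imhTilt q w π)
                  (fun U => g U / (imhAcceptMass q w U).toReal) 0) + 1 / 2)
              * ∫ U, g U ^ 2 / (imhAcceptMass q w U).toReal ∂π ∧
          ∫ U, g U ^ 2 / (imhAcceptMass q w U).toReal ∂π
            ≤ (tauInt (fun t => autocov (indepMH q w) π g t / autocov (indepMH q w) π g 0)
                + 1 / 2) * ∫ U, g U ^ 2 ∂π ∧
          (tauInt (fun t => autocov (indepMH q w) π g t / autocov (indepMH q w) π g 0) + 1 / 2)
              * ∫ U, g U ^ 2 ∂π
            ≤ (∫ U, g U ^ 2 / (imhAcceptMass q w U).toReal ∂π)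
                / (∫⁻ U, imhAcceptMass q w U ∂π).toReal := by
  subst hπB
  obtain ⟨w, hw, hlo, -, hπ, -, hα, -⟩ := flowSampler_exact_doeblin B hS hF hΦ hδ q hq
  have hw0 : ∀ U, 0 < w U := fun U => (Real.exp_pos _).trans_le (hlo U)
  have hm0 : 0 < Real.exp (-(2 * δ)) := Real.exp_pos _
  refine ⟨w, hw, hπ, hα, ?_, fun g hg C hC hg0 hV =>
    ⟨tauInt_indepMH_eq_jump hw hw0 hπ hm0 hα hg hC hg0 hV,
      harmonicMean_le_tauInt_indepMH hw hw0 hπ hm0 hα hg hC hg0 hV,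
      tauInt_indepMH_le_harmonicMean hw hw0 hπ hm0 hα hg hC hg0 hV⟩⟩
  refine Eq.trans_le ?_ (lintegral_mono hα)
  rw [lintegral_const, measure_univ, mul_one]

end Lattice
end Summit.Ventures.LatticeQCDFlow.Scoring
end
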